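import Summits.ResolutionOfSingularities.ResolutionOfSingularities.Theorems.RadicialJungCleanModelsCcurveCentreIdealRsp
import Summits.ResolutionOfSingularities.ResolutionOfSingularities.Theorems.RadicialJungCleanModelsCleanLU3ArcPackage
import Literature.AlgebraicGeometry.Resolution.LocalBlowup
import Literature.AlgebraicGeometry.Resolution.ValuationOverrings
import HarnessLib

/-!
# Route `RadicialJung`, crux `CleanModels` (stmt-15917) — (C-curve) sub-line: the shared stub `stub_Cc_centreCurve` reduced to its geometric core

Lead `res-B-lead-1` g6 (plan `Cruxes/CleanModels/Lines/Sketch-memo-Ccurve-plan.md` §1 S3; workfile `Lines/Sketch_Ccurve_assembly.lean` v2.7).  OURS · counted 0.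
Nothing here proves resolution in characteristic `p`; resolution in char `p` is NOT proved.

`centreCurve_of`: the statement of the shared stub `stub_Cc_centreCurve` (a model `B′ ⊇ B` regular of dimension `3` at the centre of `O`, same local ring at the
centre of the coarsening `O₁`, and an r.s.p. `(x, y, z)` with the centre of `O₁` EXACTLY `(x, y)`) from the GEOMETRIC CORE `hReg` = the new stub
`stub_Cc_curveRegularize` (mod F-32: after finitely many blow-ups inside `locAtCentre B O₁` the model is regular of dimension `3` at the centre of `O` and the
centre curve of `O₁` is regular there, i.e. `S′/𝔮′` is a regular local ring of dimension `1`).  The algebra is ✓ `Ccurve.exists_rsp_of_quotient_regular`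
(Matsumura 14.2) plus: `B ≤ B′ ≤ locAtCentre B O₁ ⇒ locAtCentre B′ O₁ = locAtCentre B O₁`, and `𝔮′ ≠ 𝔪′` because the two local rings have dimensions `2 ≠ 3`.
-/

noncomputable section

set_option linter.dupNamespace false

open IsLocalRing Literature.AlgebraicGeometry.Resolution
open Summit.ResolutionOfSingularities.ResolutionOfSingularities.Theorems

namespace Summit.ResolutionOfSingularities.ResolutionOfSingularities.Theorems.RadicialJung.CleanModels.Ccurve

/-- A model between `B` and `locAtCentre B O₁` has the same local ring at the centre of `O₁`. [folklore] -/
theorem locAtCentre_eq_of_le_of_le {K : Type} [Field K] {B B' : Subring K} {O₁ : ValuationSubring K}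
    (hBB' : B ≤ B') (hB' : B' ≤ locAtCentre B O₁) : locAtCentre B' O₁ = locAtCentre B O₁ := by
  refine le_antisymm ?_ (locAtCentre_mono O₁ hBB')
  have h := locAtCentre_mono O₁ hB'
  rwa [locAtCentre_locAtCentre] at h

/-- **`stub_Cc_centreCurve` from its geometric core.**  See the module docstring. [folklore] -/
theorem centreCurve_of
    (hReg :
    ∀ (k : Type) [Field k] (K : Type) [Field K] [Algebra k K]
    (O : ValuationSubring K) (A : Subalgebra k K), A.toSubring ≤ O.toSubring → A.FG → IsFractionRing A K → ringKrullDim A ≤ 3 →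
    (∀ (T : Subring K) (hT : T ≤ O.toSubring), A.toSubring ≤ T → (subringCentre T O hT).IsMaximal) →
    ∀ (B : Subalgebra k K) (hBO : B.toSubring ≤ O.toSubring), A ≤ B → B.FG →
    IsRegularLocalRing (locAtCentre B.toSubring O) → ringKrullDim (locAtCentre B.toSubring O) = 3 →
    ∀ (O₁ : ValuationSubring K) (hOO₁ : O ≤ O₁), ringKrullDim (locAtCentre B.toSubring O₁) = 2 →
    ∃ (B' : Subalgebra k K) (hB'O : B'.toSubring ≤ O.toSubring), B ≤ B' ∧ B'.FG ∧
    IsRegularLocalRing (locAtCentre B'.toSubring O) ∧ ringKrullDim (locAtCentre B'.toSubring O) = 3 ∧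
    B'.toSubring ≤ locAtCentre B.toSubring O₁ ∧
    IsRegularLocalRing (↥(locAtCentre B'.toSubring O) ⧸
      subringCentre (locAtCentre B'.toSubring O) O₁ (fun _ hw => hOO₁ (locAtCentre_le hB'O hw))) ∧
    ringKrullDim (↥(locAtCentre B'.toSubring O) ⧸
      subringCentre (locAtCentre B'.toSubring O) O₁ (fun _ hw => hOO₁ (locAtCentre_le hB'O hw))) = 1) :
    ∀ (k : Type) [Field k] (K : Type) [Field K] [Algebra k K]
    (O : ValuationSubring K) (A : Subalgebra k K), A.toSubring ≤ O.toSubring → A.FG → IsFractionRing A K → ringKrullDim A ≤ 3 →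
    (∀ (T : Subring K) (hT : T ≤ O.toSubring), A.toSubring ≤ T → (subringCentre T O hT).IsMaximal) →
    ∀ (B : Subalgebra k K) (hBO : B.toSubring ≤ O.toSubring), A ≤ B → B.FG →
    IsRegularLocalRing (locAtCentre B.toSubring O) → ringKrullDim (locAtCentre B.toSubring O) = 3 →
    ∀ (O₁ : ValuationSubring K), O ≤ O₁ → ringKrullDim (locAtCentre B.toSubring O₁) = 2 →
    ∃ (B' : Subalgebra k K) (hB'O : B'.toSubring ≤ O.toSubring), B ≤ B' ∧ B'.FG ∧
    IsRegularLocalRing (locAtCentre B'.toSubring O) ∧ ringKrullDim (locAtCentre B'.toSubring O) = 3 ∧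
    locAtCentre B'.toSubring O₁ = locAtCentre B.toSubring O₁ ∧
    ∃ (x y z : K) (hx : x ∈ locAtCentre B'.toSubring O) (hy : y ∈ locAtCentre B'.toSubring O) (hz : z ∈ locAtCentre B'.toSubring O),
      (haveI := isLocalRing_locAtCentre hB'O; IsLocalRing.maximalIdeal (locAtCentre B'.toSubring O)) =
        Ideal.span {⟨x, hx⟩, ⟨y, hy⟩, ⟨z, hz⟩} ∧
      ∀ w : ↥(locAtCentre B'.toSubring O), O₁.valuation (w : K) < 1 ↔ w ∈ Ideal.span {(⟨x, hx⟩ : ↥(locAtCentre B'.toSubring O)), ⟨y, hy⟩} := by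
  intro k _ K _ _ O A hAO hAfg hfrac hdimA hzd B hBO hAB hBfg hBreg hBdim O₁ hOO₁ hBdim₁
  classical
  obtain ⟨B', hB'O, hBB', hB'fg, hB'reg, hB'dim, hB'sub, hregq, hdimq⟩ :=
    hReg k K O A hAO hAfg hfrac hdimA hzd B hBO hAB hBfg hBreg hBdim O₁ hOO₁ hBdim₁
  haveI := isLocalRing_locAtCentre hB'O
  haveI : IsRegularLocalRing ↥(locAtCentre B'.toSubring O) := hB'reg
  have hloc : locAtCentre B'.toSubring O₁ = locAtCentre B.toSubring O₁ := locAtCentre_eq_of_le_of_le (fun w hw => hBB' hw) hB'sub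
  have h' : locAtCentre B'.toSubring O ≤ O₁.toSubring := fun _ hw => hOO₁ (locAtCentre_le hB'O hw)
  set 𝔮' := subringCentre (locAtCentre B'.toSubring O) O₁ h' with h𝔮'
  haveI : 𝔮'.IsPrime := subringCentre.isPrime _ _ h'
  haveI : IsRegularLocalRing (↥(locAtCentre B'.toSubring O) ⧸ 𝔮') := hregq
  -- `𝔮' ≠ 𝔪'`: otherwise the local rings at the centres of `O₁` and `O` coincide, of dimensions `2 ≠ 3`
  have hne : 𝔮' ≠ maximalIdeal ↥(locAtCentre B'.toSubring O) := by
    intro heq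
    have hsub : locAtCentre B'.toSubring O₁ ≤ locAtCentre B'.toSubring O := by
      rintro _ ⟨a, ha, b, hb, hvb, rfl⟩
      have hbS : b ∈ locAtCentre B'.toSubring O := le_locAtCentre _ _ hb
      have hb1 : O.valuation b = 1 := by
        by_contra hne1
        have hlt : O.valuation b < 1 := lt_of_le_of_ne ((O.valuation_le_one_iff _).mpr (hB'O hb)) hne1
        have hmem : (⟨b, hbS⟩ : ↥(locAtCentre B'.toSubring O)) ∈ maximalIdeal ↥(locAtCentre B'.toSubring O) :=
          (mem_maximalIdeal_locAtCentre_iff hB'O _).mpr hlt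
        rw [← heq, h𝔮', mem_subringCentre_iff] at hmem
        exact (lt_irrefl _) (hvb ▸ hmem : O₁.valuation b < O₁.valuation b) |> False.elim
      exact ⟨a, ha, b, hb, hb1, rfl⟩
    have hsup : locAtCentre B'.toSubring O ≤ locAtCentre B'.toSubring O₁ := by
      rintro _ ⟨a, ha, b, hb, hvb, rfl⟩
      refine ⟨a, ha, b, hb, ?_, rfl⟩
      exact le_antisymm ((O₁.valuation_le_one_iff _).mpr (hOO₁ (hB'O hb)))
        (not_lt.mp fun hlt => by
          have := valuation_lt_of_lt_of_le hOO₁ (x := b) (y := (1 : K)) (by rw [map_one]; exact hlt)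
          rw [map_one, hvb] at this; exact lt_irrefl _ this)
    have heqS : locAtCentre B'.toSubring O₁ = locAtCentre B'.toSubring O := le_antisymm hsub hsup
    have h23 : ringKrullDim ↥(locAtCentre B'.toSubring O₁) = ringKrullDim ↥(locAtCentre B'.toSubring O) := by rw [heqS]
    rw [hloc, hBdim₁, hB'dim] at h23
    exact absurd h23 (by decide)
  obtain ⟨x, y, z, hmax, hq⟩ := exists_rsp_of_quotient_regular hB'dim 𝔮' hne hdimq
  refine ⟨B', hB'O, hBB', hB'fg, hB'reg, hB'dim, hloc, x, y, z, x.2, y.2, z.2, ?_, ?_⟩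
  · exact hmax
  · intro w
    rw [← mem_subringCentre_iff h' w]
    change w ∈ 𝔮' ↔ _
    rw [hq]

end Summit.ResolutionOfSingularities.ResolutionOfSingularities.Theorems.RadicialJung.CleanModels.Ccurve

end
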